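import Summits.QuantumFields.YangMills.Theorems.BalabanUVNodesN16HolderAtRecord13OfEdges
import Summits.QuantumFields.YangMills.Theorems.BalabanUVNodesN16AtRecord13CoPOfEdges
/-!
# Route «BalabanUVNodes», cluster K4 «SpineRates» — node N16 = NE3 AT THE STAGE-13 READING OF RECORD FROM ITS TWO IN-EDGES BY NAME, LETTERS CHOSEN — THE R-β CURRENCY
# (dag-n16-c's candidate stub `S_N16Holder β`, nearest-neighbour Hölder reading, `0 ≤ β ≤ 1`): N05's leaf on `zdGF3 (M_N ℂ) F.L β len` and N07's LINEAR leaf, once per family,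
# give SOME letters of record `ℓ₃` with `S_N16Holder β (RRec₁₃CoPOn (readingOfRecord₁₃CoP w1 ℓ₃ ne2 ne1) Rg)` TOGETHER WITH dag-n21-d's numerals and the β-uniform proviso

CoP EDITION (director-ym №160–№162 «(y) FINAL», def-T KEY-23 ∕ KEY-24T, plan g68 KEY-20, dag-lead WORDS-141 — 2026-08-27): RECORD 13 v1.5 re-seeded BOTH cones at
print's collar-ranged 𝐓-weights and print's (1.7)∧(1.9)-class minimiser with scale-0 data on `suppDomOfRecord` — def-T's FILE 23 `Node00/Record13CoP.lean` carries
`towerOfRecord₁₃CoP ∕ datumOfRecord₁₃CoP` keyed on the UNCHANGED bg-free core proviso `Stage13Params.Provisos₁₃Core` and the record class `IsRecordOfRecord₁₃CCoP`; RR-2's key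
`Node00/Record13DatumKeyCoP` (`IsDatumOfRecord₁₃CCoP(On∕N)`, `IsRateKey₁₃CoP`, `canon₁₃CoP(On)`) and dag-n22-e's (T-RATE) layer-B ∕ reading-of-record CoP twins (`RateReading₁₃CoP`,
`rateCarriersOfRecord₁₃CoP`, `RRec₁₃CoP`, `RRec₁₃CoPOn`, `readingOfRecord₁₃CoP`, …) followed; the items K0⁵–K3⁵ (stmt-QuantumFields-20293–20296) key on v1.5 `Provisos₁₃SepCoP` ∕
`datumOfRecord₁₃SepCoP` (= `datumOfRecord₁₃CoP θ h.toCore`, `rfl`), so bg-blind CONSUMER storeys key ONCE on the core proviso at the CoP datum (plan CORE-YES; HOLD-ALL «rev 20 keys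
once»; the edition is FROZEN): THIS is the edition of record of this module; its ⁗ ∕ Co siblings are asides.  THIS FILE is the TOKEN TWIN of this seat's ⁗ module of the same
name with `Sep ↦ CoP` on the record ∕ datum ∕ home stems and `Provisos₁₃Sep ↦ Provisos₁₃Core` on the binder — statements = the ⁗ statements under that map; proofs verbatim;
θ-level names VERBATIM; stage-free lemmas NOT re-declared (imported from the ‴ modules BY NAME); the tuple-currency (K3 `KeyedRates rr`) conjuncts CITED from this seat's
proviso-GENERIC modules `…N16AtTupleReading13Generic` ∕ `…N16HolderMSAtTupleReading13Generic` (p512669 ∕ p512908).  NOTE (LOCATED-4∕5 of dag-n16-e ∕ dag-n16-c): every «THE N16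
LINE» below keeps the ⁗ statement's N05 conjunct on the law-free univ sub-family and is therefore VACUOUS as stated (n16-c F49); the LIVE lines with the conjunct at the pinned
all-torus proper sub-index are this seat's `…AllTorusAtRecord13CoP` modules over the faces ∕ iffs of THIS file.  The ‴∕⁗ item ids named below are ASIDES; the lane is K3⁵
`SpineGivenEndpointR13SepCoP` = stmt-QuantumFields-20296 (dag-lead WORDS-141).

Cell `pub-ymgap`, seat `pub-ymgap-dag-n16-e` (R134 acceleration seat (a), strategy s2 = BY-NAME KNIT at the record; HUMAN RULING D-0062; chair R424 venue), generation 6,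
module 28 (THEOREMS ONLY, 0 `def`, 0 `sorry`) — the third currency of module 27 `…N16AtRecord13CoPOfEdges` (β = 1 and R-β″ there), over this seat's (F2) `…N16HolderSlotWindow`
(`leafSlotHolder_ofRecord_of_window_linear`, `inEndRegimeH_ofRecord_of_window`, p485315), dag-n16-c's (E1) thresholds `radiusOfRecordH` ∕ `constOfRecordH` (p482644) and module 20's
const-layer closers `s_N16Holder_rRec₁₃CoP(On)_of_constLayer_leafSlotHolder` (p494677).  `bears_on: R4∕N16 · edges N05 → N16, N07 → N16 · out-edge N16 → N21 · K3‴ SpineGivenEndpointR13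
(stmt-QuantumFields-19912, `--supports … --as helper`)`.

CONTENT.  (The per-family `exists_letters_inEndRegimeH_leafSlotHolder_of_edges` is the ‴ module's, stage-free, imported BY NAME — per family: `∃ ℓ`, `ℓ.g = g`, `ℓ.Λ₁ = radiusOfRecordH …`, `ℓ.C = constOfRecordH … g`, N21's numerals, and
`InEndRegimeH ∧ LeafSlotHolder · β` at RR-1's object — module 27's THRESHOLD-PARAMETRIC witness `exists_window_letters_linearLeaf` at the H-thresholds), ★
`exists_letters_s_N16Holder_readingOfRecord₁₃CoPOn_of_edges` (`∃ ℓ₃`, the composer's would-be `h16` under R-β at dag-n22-e's named reading, `hpin := rfl`),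
`exists_letters_s_N16Holder_readingOfRecord₁₃CoP_of_edges` (canonical home).  The in-edge interfaces are module 27's: N05 = Thm-4 ∕ Prop-3 bodies on the univ sub-family of
`zdGF3 (M_N ℂ) F.L β len` (`len (e μ) = 1`) with constants + window; N07 = linear `LeafH3sup … ε (C·ε) (C·ε)` below a class-radius threshold; both UNGUARDED.

HONEST FRAMING.  Kernel bookkeeping by name + module 27's letter arithmetic; no estimate; N05's `Thm4Body` ∕ `Prop3Body` ([Balaban1985RegularSpaces] Thm 4 ∕ Prop 3 as typed by
n05-a) and N07's linear `LeafH3sup` ([Balaban1985Variational] Thm 1 (8)+(10) TYPE) are HYPOTHESES asserted for no family — the file CHOOSES LETTERS and proves neither edge;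
`S_N16Holder β` is a CANDIDATE stub (R-β UNRULED; nothing of record edited); localisation letters of the slot witness degenerate (files 17 ∕ 18); the reading's `w1` ∕ `ne2` ∕ `ne1` are
residual DATA; no admissible Stage-13 tuple with provisos is claimed to exist (K0‴ OPEN); nothing of Bałaban's asserted; **N16 ∕ NE3 is NOT discharged**; count-neutral (typed
28∕28 · discharged 5∕27, A 5∕28 UNMOVED); one finite four-torus at fixed ε — NOT ℝ⁴, NOT infinite volume, NOT OS, NOT a mass gap, NOT Clay.  No decl below carries a cite tag.
-/

set_option autoImplicit false

open scoped BigOperators Matrix Matrix.Norms.L2Operator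
open NormedSpace

namespace Summit.QuantumFields.YangMills.BalabanUVNodes.N16HolderAtRecord13CoPOfEdges

open Literature.MathematicalPhysics.QuantumFieldTheory.Balaban1983to89
open Literature.MathematicalPhysics.QuantumFieldTheory.Balaban1983to89.T4Continuum (T4Family ULoop)
open B7Prop1Explicit B7Prop2Explicit
open B7Prop3Flat (c3)
open B8LeafModelZd (ZdIdx)
open B8LeafModelZd3 (zdGF3)
open Node00 (IsDatumOfRecord₁₃CCoP Stage13Params NE3Objects₁₁ NE3Letters₁₁ NE2Objects₁₁ ne3ConstLayerOfRecord₁₁ ne3NperOfRecord₁₁ ne3DomOfRecord₁₁ one_le_ne3NperOfRecord₁₁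
  MatA)
open Node00.W1 (ReadingData)
open Summit.QuantumFields.BalabanUV.T4Continuum
open BlockAverageCurrent (curConst)
open NE3RightInverseSupLetters (frameC)
open NE3.LeafIndexSockets (LeafH3sup)
open YMDAG.UVSplit (Datum NE3Carriers NE1pCarriers ne3OfRecord₁₁ RRec₁₃CoP RRec₁₃CoPOn readingOfRecord₁₃CoP)
open Summit.QuantumFields.YangMills.BalabanUVNodes.N16HolderDefs (S_N16Holder)
open Summit.QuantumFields.YangMills.BalabanUVNodes.N16HolderRegime (InEndRegimeH radiusOfRecordH constOfRecordH radiusOfRecordH_pos)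
open Summit.QuantumFields.YangMills.BalabanUVNodes.N16HolderLeafSlot (LeafSlotHolder)
open Summit.QuantumFields.YangMills.BalabanUVNodes.N16AtRRec13CoPLines (s_N16Holder_rRec₁₃CoPOn_of_constLayer_leafSlotHolder s_N16Holder_rRec₁₃CoP_of_constLayer_leafSlotHolder)
open Summit.QuantumFields.YangMills.BalabanUVNodes.N16HolderAtRecord13OfEdges (exists_letters_inEndRegimeH_leafSlotHolder_of_edges)

noncomputable section

variable {N : ℕ} [NeZero N] {β : ℝ} (hβ0 : 0 ≤ β) (hβ1 : β ≤ 1) (Rg : (F : T4Family) → Stage13Params F N → Prop)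
  (w1 : (F : T4Family) → (θ : Stage13Params F N) → ReadingData F (MatA N) θ.τ9.M)
  (ne2 : (F : T4Family) → Stage13Params F N → (ℕ → ℝ) → List (ULoop F) → ℕ → NE2Objects₁₁)
  (ne1 : (F : T4Family) → Stage13Params F N → (ℕ → ℝ) → List (ULoop F) → NE1pCarriers)

include hβ0 hβ1

/-- ★ **N16 UNDER R-β AT THE REGIME-RESTRICTED READING OF RECORD FROM ITS TWO IN-EDGES, LETTERS CHOSEN** (`0 ≤ β ≤ 1`): N05's unpacked leaf at exponent `β` and N07's linear leaf
at every family, `g F > 0`, give letters `ℓ₃` with `S_N16Holder β (RRec₁₃CoPOn (readingOfRecord₁₃CoP w1 ℓ₃ ne2 ne1) Rg)` AND the per-family β-uniform proviso, leaf β-slot and N21's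
numerals (module 20 §2b's const-layer closer at `hpin := rfl`). [folklore] -/
theorem exists_letters_s_N16Holder_readingOfRecord₁₃CoPOn_of_edges {g : T4Family → ℝ} (hg : ∀ F, 0 < g F)
    (h5 : ∀ F : T4Family, letI : CStarAlgebra (Matrix (Fin N) (Fin N) ℂ) := {}
      ∃ (len : Site 4 → ℝ) (c₁ c₁' B₁' cP C₂ B₀β : ℝ) (inp : B8.B9Inputs),
        (∀ v : Site 4, 0 < len v → 1 ≤ len v) ∧ (∀ μ : Fin 4, len (e μ) = 1) ∧ 0 < B₁' ∧ 5 * ((4 : ℕ) : ℝ) * F.L * inp.B₀ ≤ B₁' ∧ 0 < c₁' ∧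
        (∀ α₀ α₁ : ℝ, 0 < α₀ → 0 < α₁ → α₀ + α₁ ≤ c₁' →
          α₀ + α₁ ≤ c₁ ∧ C0 4 * (2 * α₀) ≤ 1 / 3 ∧ 4 * α₀ ≤ c2' 4 F.L ∧ 16 * (B₁' * (α₀ + α₁)) ≤ 1 ∧
          Real.exp (4 * (800 * (((4 : ℕ) : ℝ) + 1) ^ 2 * (((4 : ℕ) : ℝ) + 4)) * α₀) * (1 + 8 * (131072 * (((4 : ℕ) : ℝ) + 1) ^ 2) * (B₁' * (α₀ + α₁))) ≤ 2 ∧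
          2 * (B₁' * (α₀ + α₁)) ≤ c3 4 F.L ∧ ((4 : ℕ) : ℝ) * F.L * α₁ ≤ 1 / 8 ∧ α₀ ≤ cP ∧ α₁ ≤ cP ∧ B₁' * (α₀ + α₁) ≤ cP ∧
          2 * (B₁' * (α₀ + α₁)) ^ 2 + 20 * ((4 : ℕ) : ℝ) * α₀ * (B₁' * (α₀ + α₁)) + 2 * C₂ * (B₁' * (α₀ + α₁)) ^ 2 ≤ α₀ + α₁) ∧
        B8.Thm4Body c₁ B₁' (fun i : {i : ZdIdx 4 F.L // i.Ω 0 = Set.univ} => (zdGF3 (Matrix (Fin N) (Fin N) ℂ) F.L β len i.1).toGFData) ∧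
        B8.Prop3Body cP 4 (F.L : ℝ) C₂ inp B₀β (fun i : {i : ZdIdx 4 F.L // i.Ω 0 = Set.univ} => (zdGF3 (Matrix (Fin N) (Fin N) ℂ) F.L β len i.1).toGFData2))
    (h7 : ∀ F : T4Family, ∃ C ε₀ : ℝ, 0 ≤ C ∧ 0 < ε₀ ∧ ∀ ε : ℝ, 0 < ε → ε ≤ ε₀ →
      LeafH3sup 4 F.L (ne3NperOfRecord₁₁ F 0 0) ε (C * ε) (C * ε) (ne3DomOfRecord₁₁ F N 0 0)) :
    ∃ ℓ₃ : T4Family → NE3Letters₁₁,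
      S_N16Holder β (RRec₁₃CoPOn (readingOfRecord₁₃CoP w1 ℓ₃ ne2 ne1) Rg) ∧
      ∀ F : T4Family, (ℓ₃ F).g = g F ∧ (ℓ₃ F).Λ₁ = radiusOfRecordH N F.L (ne3NperOfRecord₁₁ F 0 0) ∧
        (ℓ₃ F).C = constOfRecordH N F.L (ne3NperOfRecord₁₁ F 0 0) (g F) ∧
        0 < (ℓ₃ F).b ∧ 512 * (4 + 1) * (4 + 4) * (F.L : ℝ) ^ 2 * (ℓ₃ F).b ≤ 1 ∧ 0 < (ℓ₃ F).Λ₂' ∧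
        InEndRegimeH (ne3OfRecord₁₁ F (ne3ConstLayerOfRecord₁₁ F N (ℓ₃ F))) ∧ LeafSlotHolder (ne3OfRecord₁₁ F (ne3ConstLayerOfRecord₁₁ F N (ℓ₃ F))) β := by
  choose ℓ₃ hℓ₃ using fun F => exists_letters_inEndRegimeH_leafSlotHolder_of_edges (N := N) (β := β) F (hg F) (h5 F) (h7 F)
  exact ⟨ℓ₃, s_N16Holder_rRec₁₃CoPOn_of_constLayer_leafSlotHolder β _ Rg hβ0 hβ1 (fun F => ne3ConstLayerOfRecord₁₁ F N (ℓ₃ F)) (fun _ _ _ _ _ _ => rfl)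
    (fun F _ => (hℓ₃ F).2.2.2.2.2.2), hℓ₃⟩

/-- **THE SAME AT THE CANONICAL READING OF RECORD** (`S_N16Holder β (RRec₁₃CoP (readingOfRecord₁₃CoP w1 ℓ₃ ne2 ne1))`). [folklore] -/
theorem exists_letters_s_N16Holder_readingOfRecord₁₃CoP_of_edges {g : T4Family → ℝ} (hg : ∀ F, 0 < g F)
    (h5 : ∀ F : T4Family, letI : CStarAlgebra (Matrix (Fin N) (Fin N) ℂ) := {}
      ∃ (len : Site 4 → ℝ) (c₁ c₁' B₁' cP C₂ B₀β : ℝ) (inp : B8.B9Inputs),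
        (∀ v : Site 4, 0 < len v → 1 ≤ len v) ∧ (∀ μ : Fin 4, len (e μ) = 1) ∧ 0 < B₁' ∧ 5 * ((4 : ℕ) : ℝ) * F.L * inp.B₀ ≤ B₁' ∧ 0 < c₁' ∧
        (∀ α₀ α₁ : ℝ, 0 < α₀ → 0 < α₁ → α₀ + α₁ ≤ c₁' →
          α₀ + α₁ ≤ c₁ ∧ C0 4 * (2 * α₀) ≤ 1 / 3 ∧ 4 * α₀ ≤ c2' 4 F.L ∧ 16 * (B₁' * (α₀ + α₁)) ≤ 1 ∧
          Real.exp (4 * (800 * (((4 : ℕ) : ℝ) + 1) ^ 2 * (((4 : ℕ) : ℝ) + 4)) * α₀) * (1 + 8 * (131072 * (((4 : ℕ) : ℝ) + 1) ^ 2) * (B₁' * (α₀ + α₁))) ≤ 2 ∧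
          2 * (B₁' * (α₀ + α₁)) ≤ c3 4 F.L ∧ ((4 : ℕ) : ℝ) * F.L * α₁ ≤ 1 / 8 ∧ α₀ ≤ cP ∧ α₁ ≤ cP ∧ B₁' * (α₀ + α₁) ≤ cP ∧
          2 * (B₁' * (α₀ + α₁)) ^ 2 + 20 * ((4 : ℕ) : ℝ) * α₀ * (B₁' * (α₀ + α₁)) + 2 * C₂ * (B₁' * (α₀ + α₁)) ^ 2 ≤ α₀ + α₁) ∧
        B8.Thm4Body c₁ B₁' (fun i : {i : ZdIdx 4 F.L // i.Ω 0 = Set.univ} => (zdGF3 (Matrix (Fin N) (Fin N) ℂ) F.L β len i.1).toGFData) ∧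
        B8.Prop3Body cP 4 (F.L : ℝ) C₂ inp B₀β (fun i : {i : ZdIdx 4 F.L // i.Ω 0 = Set.univ} => (zdGF3 (Matrix (Fin N) (Fin N) ℂ) F.L β len i.1).toGFData2))
    (h7 : ∀ F : T4Family, ∃ C ε₀ : ℝ, 0 ≤ C ∧ 0 < ε₀ ∧ ∀ ε : ℝ, 0 < ε → ε ≤ ε₀ →
      LeafH3sup 4 F.L (ne3NperOfRecord₁₁ F 0 0) ε (C * ε) (C * ε) (ne3DomOfRecord₁₁ F N 0 0)) :
    ∃ ℓ₃ : T4Family → NE3Letters₁₁,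
      S_N16Holder β (RRec₁₃CoP (readingOfRecord₁₃CoP w1 ℓ₃ ne2 ne1)) ∧
      ∀ F : T4Family, (ℓ₃ F).g = g F ∧ (ℓ₃ F).Λ₁ = radiusOfRecordH N F.L (ne3NperOfRecord₁₁ F 0 0) ∧
        (ℓ₃ F).C = constOfRecordH N F.L (ne3NperOfRecord₁₁ F 0 0) (g F) ∧
        0 < (ℓ₃ F).b ∧ 512 * (4 + 1) * (4 + 4) * (F.L : ℝ) ^ 2 * (ℓ₃ F).b ≤ 1 ∧ 0 < (ℓ₃ F).Λ₂' ∧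
        InEndRegimeH (ne3OfRecord₁₁ F (ne3ConstLayerOfRecord₁₁ F N (ℓ₃ F))) ∧ LeafSlotHolder (ne3OfRecord₁₁ F (ne3ConstLayerOfRecord₁₁ F N (ℓ₃ F))) β := by
  choose ℓ₃ hℓ₃ using fun F => exists_letters_inEndRegimeH_leafSlotHolder_of_edges (N := N) (β := β) F (hg F) (h5 F) (h7 F)
  exact ⟨ℓ₃, s_N16Holder_rRec₁₃CoP_of_constLayer_leafSlotHolder β _ hβ0 hβ1 (fun F => ne3ConstLayerOfRecord₁₁ F N (ℓ₃ F)) (fun _ _ _ _ _ _ => rfl)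
    (fun F _ => (hℓ₃ F).2.2.2.2.2.2), hℓ₃⟩

end

end Summit.QuantumFields.YangMills.BalabanUVNodes.N16HolderAtRecord13CoPOfEdges
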